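import Summits.Parity.GeneralizedHardyLittlewood.Theses.LeeYangFibres
import Summits.Parity.GeneralizedHardyLittlewood.Theorems.LeeYangFibresCellsToRelativeDimOne
import Summits.Parity.GeneralizedHardyLittlewood.Theorems.LeeYangFibresRelativeDimOne
import Summits.Parity.GeneralizedHardyLittlewood.Theorems.LeeYangFibresPrimeCellsRelativeUpTransfer
import Summits.Parity.GeneralizedHardyLittlewood.Theorems.LeeYangFibresPrimeCellsRelativeDimOneOne
import HarnessLib

/-!
# Crux `PrimeCellsRelative` (stmt-Parity-14112), line `Sketch`: the locator lemmas (sorry-free)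

With the three provable stubs of the line landed (`stub_cellsArithUp`, `stub_upTransfer`, `stub_dimOne_one`),
this file records the kernel-checked LOGICAL POSITION of the crux `PrimeCellsRelative` (counting
Dickson–Hardy–Littlewood for rough prime cells, Green–Tao Conj. 1.4 error shape) inside route `LeeYangFibres`:

* `relative_of_absolute` — at a fixed number of forms `t`, the absolute error `ε N` (shape of `DimOne`)
  implies the relative + absolute error `ε (β_∞ ∏_p β_p + N)` (shape of `RelativeDimOne`);
* `primeCellsRelative_of_relativeDimOne : RelativeDimOne → PrimeCellsRelative` — the up-transfer (card
  `crux-locator`, lemma L1-up); together with item stmt-Parity-14115 (`cellsToRelativeDimOne_proof`, PROVED)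
  this gives `primeCellsRelative_iff_relativeDimOne`: items 14112 and 14113 are ONE node;
* `primeCellsRelative_of_dimOne : DimOne → PrimeCellsRelative` — the crux is a corollary of the shared target
  stmt-Parity-0819 (`relativeDimOne_of_dimOne`, PROVED);
* `primeCellsRelative_of_generalizedHardyLittlewood` — necessity: the sub-problem Statement (Green–Tao Conj. 1.2)
  implies the crux (its `d = 1` slice is `DimOne`);
* `primeCellsRelative_at_one` — **the `t = 1` slice of the crux is a THEOREM** (unconditional: Green–Tao 2010
  Thm 4.5 at level `s = 1`, proved in the tree, through `stub_dimOne_one`, `relative_of_absolute` and the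
  up-transfer);
* `primeCellsRelative_of_relativeDimOne_two_le` — what is left: the crux follows from `RelativeDimOne`
  restricted to systems of `t ≥ 2` forms (the registered open stub `stub_relativeDimOne_two_le` of the line);
* `primeCellsRelative_implies_twinPrimeConjecture` — hardness certificate: the crux implies the twin prime
  conjecture (`twinPrimeConjecture_of_relativeDimOne`, PROVED), so it cannot be closed short of it.

References: B. Green, T. Tao, *Linear equations in primes*, Ann. of Math. 171 (2010), Conj. 1.2, Conj. 1.4 and
the sketch proof after (1.8), Thm 4.5 [GreenTao2010]; G. H. Hardy, J. E. Littlewood, *Partitio Numerorum III*,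
Acta Math. 44 (1923) [HardyLittlewood1923].
-/

noncomputable section

namespace Summit.Parity.GeneralizedHardyLittlewood.Cruxes.PrimeCellsRelative.Sketch

open scoped BigOperators Topology Classical
open Filter Finset Literature.NumberTheory.Sieve
open Summit.Parity.GeneralizedHardyLittlewood.Theses.LeeYangFibres

/-- **Absolute ⟹ relative error at fixed `t`** (the proof of `relativeDimOne_of_dimOne`, sliced by the
number of forms): from `|S - M| ≤ ε' N` and `S ≥ 0` one gets `M ≥ -N/2`, so `ε (M + N) ≥ ε N / 2 ≥ ε' N`
for `ε' = min ε 1 / 2`. [cite: GreenTao2010, Conj. 1.2 and Conj. 1.4] -/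
theorem relative_of_absolute (t : ℕ)
    (hD : ∀ L : ℕ, ∀ ε : ℝ, 0 < ε → ∃ N₀ : ℕ, ∀ N : ℕ, N₀ ≤ N → ∀ Ψ : Fin t → Literature.NumberTheory.Sieve.AffLinForm 1, Literature.NumberTheory.Sieve.IsNondegenerateSystem Ψ → Literature.NumberTheory.Sieve.affLinSize Ψ N ≤ L → ∀ K : Set (Fin 1 → ℝ), Convex ℝ K → K ⊆ Literature.NumberTheory.Sieve.realBox 1 N → |Literature.NumberTheory.Sieve.vonMangoldtSum Ψ K N - Literature.NumberTheory.Sieve.archFactor Ψ K * Literature.NumberTheory.Sieve.singularProduct Ψ| ≤ ε * (N : ℝ)) :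
    ∀ L : ℕ, ∀ ε : ℝ, 0 < ε → ∃ N₀ : ℕ, ∀ N : ℕ, N₀ ≤ N → ∀ Ψ : Fin t → Literature.NumberTheory.Sieve.AffLinForm 1, Literature.NumberTheory.Sieve.IsNondegenerateSystem Ψ → Literature.NumberTheory.Sieve.affLinSize Ψ N ≤ L → ∀ K : Set (Fin 1 → ℝ), Convex ℝ K → K ⊆ Literature.NumberTheory.Sieve.realBox 1 N → |Literature.NumberTheory.Sieve.vonMangoldtSum Ψ K N - Literature.NumberTheory.Sieve.archFactor Ψ K * Literature.NumberTheory.Sieve.singularProduct Ψ| ≤ ε * (Literature.NumberTheory.Sieve.archFactor Ψ K * Literature.NumberTheory.Sieve.singularProduct Ψ + N) := by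
  intro L ε hε
  obtain ⟨N₀, hN₀⟩ := hD L (min ε 1 / 2) (by positivity)
  refine ⟨N₀, fun N hN Ψ hΨ hL K hK hKN => ?_⟩
  have hb := hN₀ N hN Ψ hΨ hL K hK hKN
  have hS := Theorems.LeeYangFibresRelativeDimOne.vonMangoldtSum_nonneg Ψ K N
  set S := vonMangoldtSum Ψ K N with hSdef
  set M := archFactor Ψ K * singularProduct Ψ with hMdef
  have hN0 : (0 : ℝ) ≤ N := Nat.cast_nonneg N
  have hε1 : min ε 1 / 2 ≤ ε / 2 := by
    have := min_le_left ε 1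
    linarith
  have hε2 : min ε 1 / 2 ≤ 1 / 2 := by
    have := min_le_right ε 1
    linarith
  have hab := abs_le.mp hb
  have hM : -(1 / 2 * (N : ℝ)) ≤ M := by
    have h1 : min ε 1 / 2 * (N : ℝ) ≤ 1 / 2 * N := mul_le_mul_of_nonneg_right hε2 hN0
    linarith [hab.1, hab.2]
  have hεM : -(ε / 2 * (N : ℝ)) ≤ ε * M := by
    have := mul_le_mul_of_nonneg_left hM hε.le
    linarith
  have h2 : min ε 1 / 2 * (N : ℝ) ≤ ε / 2 * N := mul_le_mul_of_nonneg_right hε1 hN0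
  calc |S - M| ≤ min ε 1 / 2 * (N : ℝ) := hb
    _ ≤ ε * (M + N) := by nlinarith

/-- **Location lemma L1 (up): `RelativeDimOne → PrimeCellsRelative`.** The Λ-weighted `d = 1` asymptotic
with Green–Tao's relative + absolute error gives back the rough prime cells with the same error shape, for
every number of forms `t` (`stub_upTransfer`, Green–Tao's sandwich run forwards). [cite: GreenTao2010, Conj. 1.4 (sketch proof)] -/
theorem primeCellsRelative_of_relativeDimOne : RelativeDimOne → PrimeCellsRelative :=
  fun hR t L ht ε hε => stub_upTransfer t ht (fun L' ε' hε' => hR t L' ht ε' hε') L ε hε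

/-- **The crux collapses onto its successor node: `PrimeCellsRelative ↔ RelativeDimOne`** (items
stmt-Parity-14112 ≡ stmt-Parity-14113). Down: item stmt-Parity-14115 `cellsToRelativeDimOne_proof` (PROVED);
up: `primeCellsRelative_of_relativeDimOne`. [cite: GreenTao2010, Conj. 1.4 (sketch proof)] -/
theorem primeCellsRelative_iff_relativeDimOne : PrimeCellsRelative ↔ RelativeDimOne :=
  ⟨Theorems.LeeYangFibresCells.cellsToRelativeDimOne_proof, primeCellsRelative_of_relativeDimOne⟩

/-- **The crux is a corollary of the shared target `DimOne` (stmt-Parity-0819)**, through the PROVED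
`relativeDimOne_of_dimOne` and the up-transfer. [cite: GreenTao2010, Conj. 1.2] -/
theorem primeCellsRelative_of_dimOne : DimOne → PrimeCellsRelative :=
  fun h => primeCellsRelative_of_relativeDimOne
    (Theorems.LeeYangFibresRelativeDimOne.relativeDimOne_of_dimOne h)

/-- **Necessity certificate: the sub-problem Statement implies the crux.** `GeneralizedHardyLittlewood`
(Green–Tao Conj. 1.2, the summit conjunct) specialised to `d = 1` is `DimOne`, whence `PrimeCellsRelative` by
`primeCellsRelative_of_dimOne`: the crux is a NECESSARY node (true whenever the Statement is), bracketed
`GeneralizedHardyLittlewood ⟹ PrimeCellsRelative ⟹ TwinPrimeConjecture`. [cite: GreenTao2010, Conj. 1.2] -/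
theorem primeCellsRelative_of_generalizedHardyLittlewood :
    _root_.GeneralizedHardyLittlewood → PrimeCellsRelative := by
  intro hG
  refine primeCellsRelative_of_dimOne fun t L ht ε hε => ?_
  obtain ⟨N₀, hN₀⟩ := hG 1 t L le_rfl ht ε hε
  refine ⟨N₀, fun N hN Ψ hΨ hL K hK hKN => ?_⟩
  simpa only [pow_one] using hN₀ N hN Ψ hΨ hL K hK hKN

/-- **The `t = 1` slice of the crux is a theorem (unconditional).** For every `L` and `ε > 0` there are
`u ≥ 2` and `N₀` such that for `N ≥ N₀`, uniformly over non-degenerate one-form systems `ψ(n) = a n + b`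
(`|a| ≤ L`, `|b| ≤ L N`) and convex `K ⊆ [-N, N]`: the number of `n ∈ K ∩ ℤ` with `ψ(n)` a prime `> N^{1/u}`
is `β_∞ ∏_p β_p · A₁(N)/N` up to `ε (β_∞ ∏_p β_p · A₁(N)/N + N / log N)` — primes in progression segments,
from Green–Tao 2010 Thm 4.5 at level `1` (`stub_dimOne_one`, via Siegel–Walfisz in the tree),
`relative_of_absolute` and the up-transfer `stub_upTransfer`. [cite: GreenTao2010, Thm 4.5 and Conj. 1.4] -/
theorem primeCellsRelative_at_one :
    ∀ L : ℕ, ∀ ε : ℝ, 0 < ε → ∃ u : ℕ, 2 ≤ u ∧ ∃ N₀ : ℕ, ∀ N : ℕ, N₀ ≤ N → ∀ Ψ : Fin 1 → Literature.NumberTheory.Sieve.AffLinForm 1, Literature.NumberTheory.Sieve.IsNondegenerateSystem Ψ → Literature.NumberTheory.Sieve.affLinSize Ψ N ≤ L → ∀ K : Set (Fin 1 → ℝ), Convex ℝ K → K ⊆ Literature.NumberTheory.Sieve.realBox 1 N → |((((Literature.NumberTheory.Sieve.latticeBox 1 N).filter (fun n => Literature.NumberTheory.Sieve.realPoint n ∈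 K ∧ ∀ i, (N : ℝ) ^ ((1 : ℝ) / u) < (Nat.minFac ((Ψ i).eval n).toNat : ℝ) ∧ ArithmeticFunction.cardFactors ((Ψ i).eval n).toNat = 1)).card : ℕ) : ℝ) - Literature.NumberTheory.Sieve.archFactor Ψ K * Literature.NumberTheory.Sieve.singularProduct Ψ * (((((Finset.Icc 1 N).filter (fun m => (N : ℝ) ^ ((1 : ℝ) / u) < (Nat.minFac m : ℝ) ∧ ArithmeticFunction.cardFactors m = 1)).card : ℕ) : ℝ) / N) ^ 1| ≤ ε * (Literature.NumberTheory.Sieve.archFactor Ψ K * Literature.NumberTheory.Sieve.singularProduct Ψ * (((((Finset.Icc 1 N).filter (fun m => (N : ℝ) ^ ((1 : ℝ) / u) < (Nat.minFac m : ℝ) ∧ ArithmeticFunction.cardFactors m = 1)).card : ℕ) : ℝ) / N) ^ 1 + N / Real.log N ^ 1) :=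
  stub_upTransfer 1 le_rfl (relative_of_absolute 1 stub_dimOne_one)

/-- **What is left of the crux after the line's provable stubs:** `PrimeCellsRelative` follows from
`RelativeDimOne` restricted to systems of `t ≥ 2` forms (the registered OPEN stub
`stub_relativeDimOne_two_le` of the line `Sketch`; Hardy–Littlewood prime tuples in relative accuracy `o(1)`).
The case `t = 1` is supplied by `primeCellsRelative_at_one`. [cite: GreenTao2010, Conj. 1.2 and Conj. 1.4] -/
theorem primeCellsRelative_of_relativeDimOne_two_le
    (h2 : ∀ t : ℕ, 2 ≤ t → ∀ L : ℕ, ∀ ε : ℝ, 0 < ε → ∃ N₀ : ℕ, ∀ N : ℕ, N₀ ≤ N → ∀ Ψ : Fin t → Literature.NumberTheory.Sieve.AffLinForm 1, Literature.NumberTheory.Sieve.IsNondegenerateSystem Ψ → Literature.NumberTheory.Sieve.affLinSize Ψ N ≤ L → ∀ K : Set (Fin 1 → ℝ), Convex ℝ K → K ⊆ Literature.NumberTheory.Sieve.realBox 1 N → |Literature.NumberTheory.Sieve.vonMangoldtSum Ψ K N - Literature.NumberTheory.Sieve.archFactor Ψ K * Literature.NumberTheory.Sieve.singularProduct Ψ|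 ≤ ε * (Literature.NumberTheory.Sieve.archFactor Ψ K * Literature.NumberTheory.Sieve.singularProduct Ψ + N)) :
    PrimeCellsRelative := by
  intro t L ht ε hε
  rcases Nat.lt_or_ge t 2 with ht2 | ht2
  · obtain rfl : t = 1 := by omega
    exact primeCellsRelative_at_one L ε hε
  · exact stub_upTransfer t ht (h2 t ht2) L ε hε

/-- **Hardness certificate: `PrimeCellsRelative → TwinPrimeConjecture`.** The crux implies `RelativeDimOne`
(item stmt-Parity-14115, PROVED) which implies the twin prime conjecture
(`twinPrimeConjecture_of_relativeDimOne`, PROVED): the crux cannot be closed short of the twin prime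
conjecture in Hardy–Littlewood strength. [cite: HardyLittlewood1923, Conjecture B] -/
theorem primeCellsRelative_implies_twinPrimeConjecture :
    PrimeCellsRelative → Literature.NumberTheory.Sieve.TwinPrimeConjecture := fun h =>
  Theorems.LeeYangFibresRelativeDimOne.twinPrimeConjecture_of_relativeDimOne
    (Theorems.LeeYangFibresCells.cellsToRelativeDimOne_proof h)

end Summit.Parity.GeneralizedHardyLittlewood.Cruxes.PrimeCellsRelative.Sketch

end
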